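import Literature.NumberTheory.Rogawski1990.ArchTransfFamily          -- ★ p849747: brings ★ (COORD) `archRH`∕`RegS` and the atlas `boostEig`
import Literature.NumberTheory.Automorphic.ArchEndoscopicChartOrbitalSmooth   -- ★ (LH3-p01 (g3)): `contDiffOn_archRH_regS` (reused, not restated)
import Mathlib.Analysis.Calculus.Deriv.Abs
import Mathlib.Analysis.InnerProductSpace.Calculus
import Mathlib.Analysis.SpecialFunctions.ExpDeriv
import HarnessLib

/-!
# (GLUE-X-dress) FILE A2 — the prefactor `R_H · M♭` of the paired partner sum is `C^∞` on the `H`-regular set `RegS S`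
# (Rogawski 1990 §4.9 p. 55, §8.2 p. 118; Shelstad 1979 §4 p. 22)

Topic `NumberTheory/Rogawski1990`; namespace `Literature.NumberTheory.Rogawski1990`.  THEOREMS ONLY (no `def`, no instance, no notation, no axiom, no named fact, no `sorry`).
Cell `pub/hodgecm-mathlib`, crux H413 (`stmt-HodgeConjecture-24833`), F0∕P3c line LH3 (closer stub `stub_N9`, DIRECT ROAD «Transf», organ O-L2); brick **(GLUE-X-dress)** of
LH3-plan (g2)'s ruling 2026-09-02T06:35:47Z, FILE A2 (analysis of the PREFACTOR only); seat F0P3a-p09 (g5).  FILE A1 (`ArchTransfFamilyMirrorPairing`) rewrote the partner sum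
★ `transfFamReg` on `RegG S` as `(archRH S c · w_S · M♭_k(c)) · Σ_ρ (K_ρσ(ρ))·'F(ρ·c)`; here: **the prefactor is `C^∞` on the whole `H`-regular set `RegS S`** — ACROSS the
`G`-walls `e^{ic_w1} = e^{ic_w0}`, `e^{ic_w1} = e^{ic_w2}` (which it no longer sees) — so the smoothness of `transfFam` across those walls is reduced to the twisted family
bracket (FILE B).

THE FUNCTIONS (coordinates `c : W → Fin 3 → ℝ`, eigenvalues `E_wi = e^{ic_wi}` at a compact place, `boostEig (c w) = (e^{x+iθ}, e^{iφ}, e^{−x+iθ})` at a split place):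
* ★ `archRH S c = Π_w [w ∈ S: |e^{x_w} − e^{−x_w}| ; w ∉ S: 1 − e^{i(c_w2−c_w0)}]` — `C^∞` where `x_w ≠ 0` at the split places (★ `contDiffOn_archRH_regS`, LH3-p01 (g3));
* `M♭_k(c) = Π_w [w ∈ S: (τD)_w(c) ∕ R′_w(c) ; w ∉ S: (E_w0E_w2)^{k_w}·E_w0E_w2 ∕ (E_w0 − E_w2)]` with `(τD)_w = −((E₀E₂)^{k_w}(E₁−E₀)(E₁−E₂))∕E₁` (`E = boostEig`) and
  `R′_w = |e^x−e^{−x}|·|e^{x+iθ}−e^{iφ}|·|e^{−x+iθ}−e^{iφ}|` — `C^∞` where `E_w0 ≠ E_w2` (compact) and `x_w ≠ 0` (split), i.e. on `RegS S` (`contDiffOn_prefactor`):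
  integer powers of unit exponentials are exponentials (`(e^{ia}e^{ib})^k = e^{ik(a+b)}`), `|·|` and `‖·‖` are `C^∞` off `0` (Mathlib `contDiffAt_abs`, `ContDiffAt.norm`).
* **`contDiffOn_archRH_mul_prefactor`** — the product (times any constant, e.g. ★ `partnerWeight`) is `C^∞` on `RegS S`.
HONEST LABEL: HC_CM is proved only modulo the 7 printed citations (2 remaining named inputs: hLiu418 = `stmt-HodgeConjecture-24832`, h413 = `stmt-HodgeConjecture-24833`) until rung 0
closes; count-neutral calculus under O-L2, pays no organ.

## References
* [Rogawski1990] J. D. Rogawski, *Automorphic Representations of Unitary Groups in Three Variables*, Ann. of Math. Stud. 123 (1990), §4.9 p. 55, §8.2 p. 118, §3.6 p. 31.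
* [Shelstad1979] D. Shelstad, *Characters and inner forms of a quasi-split group over ℝ*, Compositio Math. 39 (1979), §4 p. 22 (`R_T` on `T_reg`).
-/

set_option autoImplicit false

noncomputable section

open Complex Finset
open scoped ContDiff
open Literature.NumberTheory.Automorphic Literature.NumberTheory.Automorphic.UnitaryGroup Literature.NumberTheory.Automorphic.ArchCartan

namespace Literature.NumberTheory.Rogawski1990

variable {W : Type*} [Fintype W] [DecidableEq W]

/-! ## §1 Coordinates and unit exponentials are smooth -/

omit [DecidableEq W] in
/-- The coordinate `c ↦ c w i` is `C^∞` (a continuous linear map). [folklore] [cite: Shelstad1979, §4 p. 22] -/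
theorem contDiff_coord (w : W) (i : Fin 3) : ContDiff ℝ ∞ (fun c : W → Fin 3 → ℝ => c w i) :=
  (contDiff_apply (𝕜 := ℝ) (E := ℝ) (n := ∞) i).comp (contDiff_apply (𝕜 := ℝ) (E := Fin 3 → ℝ) (n := ∞) w)

omit [DecidableEq W] in
/-- The coordinate as a complex number is `C^∞`. [folklore] [cite: Shelstad1979, §4 p. 22] -/
theorem contDiff_coe_coord (w : W) (i : Fin 3) : ContDiff ℝ ∞ (fun c : W → Fin 3 → ℝ => (c w i : ℂ)) :=
  ofRealCLM.contDiff.comp (contDiff_coord w i)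

omit [DecidableEq W] in
/-- `c ↦ e^{z(c)}` is `C^∞` for a `C^∞` complex exponent `z`. [folklore] [cite: Shelstad1979, §4 p. 22] -/
theorem contDiff_cexp_comp {z : (W → Fin 3 → ℝ) → ℂ} (hz : ContDiff ℝ ∞ z) : ContDiff ℝ ∞ (fun c => Complex.exp (z c)) :=
  Complex.contDiff_exp.comp hz

omit [DecidableEq W] in
/-- The unit eigenvalue `c ↦ e^{ic_wi}` (★ `Circle.exp`, as a complex number) is `C^∞`. [cite: Rogawski1990, §3.6 p. 31] -/
theorem contDiff_coe_circleExp_coord (w : W) (i : Fin 3) : ContDiff ℝ ∞ (fun c : W → Fin 3 → ℝ => (Circle.exp (c w i) : ℂ)) := by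
  have h : (fun c : W → Fin 3 → ℝ => (Circle.exp (c w i) : ℂ)) = fun c => Complex.exp ((c w i : ℂ) * I) := by
    funext c; exact Circle.coe_exp _
  rw [h]
  exact contDiff_cexp_comp ((contDiff_coe_coord w i).mul contDiff_const)

omit [DecidableEq W] in
/-- An INTEGER power of a product of unit eigenvalues is an exponential, hence `C^∞`: `(e^{ia}e^{ib})^k = e^{ik(a+b)}`. [cite: Rogawski1990, §4.9 p. 55] -/
theorem contDiff_coe_circleExp_mul_zpow (w : W) (i j : Fin 3) (k : ℤ) :
    ContDiff ℝ ∞ (fun c : W → Fin 3 → ℝ => ((Circle.exp (c w i) : ℂ) * Circle.exp (c w j)) ^ k) := by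
  have h : (fun c : W → Fin 3 → ℝ => ((Circle.exp (c w i) : ℂ) * Circle.exp (c w j)) ^ k) =
      fun c => Complex.exp ((k : ℂ) * (((c w i : ℂ) + (c w j : ℂ)) * I)) := by
    funext c
    rw [Circle.coe_exp, Circle.coe_exp, ← Complex.exp_add, ← Complex.exp_int_mul]
    congr 1; ring
  rw [h]
  exact contDiff_cexp_comp (contDiff_const.mul (((contDiff_coe_coord w i).add (contDiff_coe_coord w j)).mul contDiff_const))

omit [DecidableEq W] in
/-- The boost eigenvalues `boostEig (c w) i` are `C^∞` in `c`. [cite: Rogawski1990, §3.6 p. 31] -/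
theorem contDiff_boostEig_coord (w : W) (i : Fin 3) : ContDiff ℝ ∞ (fun c : W → Fin 3 → ℝ => boostEig (c w) i) := by
  fin_cases i
  · show ContDiff ℝ ∞ (fun c : W → Fin 3 → ℝ => Complex.exp ((c w 0 : ℂ) + (c w 2 : ℂ) * I))
    exact contDiff_cexp_comp ((contDiff_coe_coord w 0).add ((contDiff_coe_coord w 2).mul contDiff_const))
  · show ContDiff ℝ ∞ (fun c : W → Fin 3 → ℝ => Complex.exp ((c w 1 : ℂ) * I))
    exact contDiff_cexp_comp ((contDiff_coe_coord w 1).mul contDiff_const)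
  · show ContDiff ℝ ∞ (fun c : W → Fin 3 → ℝ => Complex.exp (-(c w 0 : ℂ) + (c w 2 : ℂ) * I))
    exact contDiff_cexp_comp ((contDiff_coe_coord w 0).neg.add ((contDiff_coe_coord w 2).mul contDiff_const))

omit [DecidableEq W] in
/-- The integer power `(E₀E₂)^k` of the boost eigenvalues is an exponential, hence `C^∞`: `e^{x+iθ}e^{−x+iθ} = e^{2iθ}`. [cite: Rogawski1990, §3.6 p. 31] -/
theorem contDiff_boostEig_mul_zpow (w : W) (k : ℤ) :
    ContDiff ℝ ∞ (fun c : W → Fin 3 → ℝ => (boostEig (c w) 0 * boostEig (c w) 2) ^ k) := by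
  have h : (fun c : W → Fin 3 → ℝ => (boostEig (c w) 0 * boostEig (c w) 2) ^ k) = fun c => Complex.exp ((k : ℂ) * ((2 : ℂ) * (c w 2 : ℂ) * I)) := by
    funext c
    show (Complex.exp ((c w 0 : ℂ) + (c w 2 : ℂ) * I) * Complex.exp (-(c w 0 : ℂ) + (c w 2 : ℂ) * I)) ^ k = _
    rw [← Complex.exp_add, ← Complex.exp_int_mul]
    congr 1; ring
  rw [h]
  exact contDiff_cexp_comp (contDiff_const.mul ((contDiff_const.mul (contDiff_coe_coord w 2)).mul contDiff_const))

/-! ## §2 `R_H` is smooth on the `H`-regular set: ★ `ArchCartan.contDiffOn_archRH_regS` (LH3-p01 (g3)), reused below -/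

/-! ## §3 The prefactor `M♭` is smooth on the `H`-regular set -/

/-- **The prefactor `M♭_k` of FILE A1 is `C^∞` on `RegS S`** — across the `G`-walls, which it does not see: at a compact place `(E₀E₂)^k E₀E₂∕(E₀−E₂)` is smooth where
`e^{ic_w0} ≠ e^{ic_w2}`; at a split place `(τD)_w ∕ R′_w` is smooth where `x_w ≠ 0` (`R′_w ≠ 0` there, `|·|`, `‖·‖` smooth off `0`). [cite: Rogawski1990, §4.9 p. 55; §8.2 p. 118]
[cite: Shelstad1979, §4 p. 22] -/
theorem contDiffOn_prefactor (S : Finset W) (k : W → ℤ) :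
    ContDiffOn ℝ ∞ (fun c : W → Fin 3 → ℝ => ∏ w : W, (if w ∈ S then
          -((((boostEig (c w) 0) * (boostEig (c w) 2)) ^ (k w)) * (((boostEig (c w) 1) - (boostEig (c w) 0)) * ((boostEig (c w) 1) - (boostEig (c w) 2))) /
              (boostEig (c w) 1)) /
            ((|Real.exp (c w 0) - Real.exp (-c w 0)| *
                ‖Complex.exp (c w 0 + c w 2 * I) - Complex.exp (c w 1 * I)‖ * ‖Complex.exp (-c w 0 + c w 2 * I) - Complex.exp (c w 1 * I)‖ : ℝ) : ℂ)
        else (((Circle.exp (c w 0) : ℂ) * Circle.exp (c w 2)) ^ (k w)) * ((Circle.exp (c w 0) : ℂ) * Circle.exp (c w 2)) /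
          ((Circle.exp (c w 0) : ℂ) - Circle.exp (c w 2)))) (RegS S) := by
  intro c hc
  refine ContDiffAt.contDiffWithinAt ?_
  refine contDiffAt_prod (fun w _ => ?_)
  by_cases hw : w ∈ S
  · simp only [if_pos hw]
    have hx : c w 0 ≠ 0 := ((mem_regS_iff S c).1 hc).2 w hw
    -- numerator: entire
    have hnum : ContDiff ℝ ∞ (fun c : W → Fin 3 → ℝ =>
        -((((boostEig (c w) 0) * (boostEig (c w) 2)) ^ (k w)) * (((boostEig (c w) 1) - (boostEig (c w) 0)) * ((boostEig (c w) 1) - (boostEig (c w) 2))) /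
          (boostEig (c w) 1))) := by
      simp only [div_eq_mul_inv]
      refine ContDiff.neg (((contDiff_boostEig_mul_zpow w (k w)).mul
        (((contDiff_boostEig_coord w 1).sub (contDiff_boostEig_coord w 0)).mul ((contDiff_boostEig_coord w 1).sub (contDiff_boostEig_coord w 2)))).mul
        ((contDiff_boostEig_coord w 1).inv fun c => ?_))
      show Complex.exp ((c w 1 : ℂ) * I) ≠ 0
      exact Complex.exp_ne_zero _
    -- denominator: smooth off `x = 0`, non-zero there
    have hE0 : ContDiff ℝ ∞ (fun c : W → Fin 3 → ℝ => Complex.exp ((c w 0 : ℂ) + (c w 2 : ℂ) * I) - Complex.exp ((c w 1 : ℂ) * I)) :=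
      (contDiff_cexp_comp ((contDiff_coe_coord w 0).add ((contDiff_coe_coord w 2).mul contDiff_const))).sub
        (contDiff_cexp_comp ((contDiff_coe_coord w 1).mul contDiff_const))
    have hE2 : ContDiff ℝ ∞ (fun c : W → Fin 3 → ℝ => Complex.exp (-(c w 0 : ℂ) + (c w 2 : ℂ) * I) - Complex.exp ((c w 1 : ℂ) * I)) :=
      (contDiff_cexp_comp ((contDiff_coe_coord w 0).neg.add ((contDiff_coe_coord w 2).mul contDiff_const))).sub
        (contDiff_cexp_comp ((contDiff_coe_coord w 1).mul contDiff_const))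
    have hne : Real.exp (c w 0) - Real.exp (-c w 0) ≠ 0 := fun h => ((abs_exp_sub_exp_neg_ne_zero_iff (c w 0)).2 hx) (by rw [h, abs_zero])
    have hn1 : Complex.exp ((c w 0 : ℂ) + (c w 2 : ℂ) * I) - Complex.exp ((c w 1 : ℂ) * I) ≠ 0 :=
      norm_ne_zero_iff.1 (norm_exp_add_mul_I_sub_exp_mul_I_ne_zero hx _ _)
    have hn2 : Complex.exp (-(c w 0 : ℂ) + (c w 2 : ℂ) * I) - Complex.exp ((c w 1 : ℂ) * I) ≠ 0 := by
      have h := norm_exp_add_mul_I_sub_exp_mul_I_ne_zero (neg_ne_zero.2 hx) (c w 2) (c w 1)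
      rw [Complex.ofReal_neg] at h
      exact norm_ne_zero_iff.1 h
    have hden : ContDiffAt ℝ ∞ (fun c : W → Fin 3 → ℝ => ((|Real.exp (c w 0) - Real.exp (-c w 0)| *
        ‖Complex.exp (c w 0 + c w 2 * I) - Complex.exp (c w 1 * I)‖ * ‖Complex.exp (-c w 0 + c w 2 * I) - Complex.exp (c w 1 * I)‖ : ℝ) : ℂ)) c := by
      refine ofRealCLM.contDiff.contDiffAt.comp c ?_
      refine ((?_ : ContDiffAt ℝ ∞ _ c).mul (hE0.contDiffAt.norm ℝ hn1)).mul (hE2.contDiffAt.norm ℝ hn2)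
      exact ((Real.contDiff_exp.comp (contDiff_coord w 0)).sub (Real.contDiff_exp.comp (contDiff_coord w 0).neg)).contDiffAt.abs hne
    have hden0 : (((|Real.exp (c w 0) - Real.exp (-c w 0)| *
        ‖Complex.exp (c w 0 + c w 2 * I) - Complex.exp (c w 1 * I)‖ * ‖Complex.exp (-c w 0 + c w 2 * I) - Complex.exp (c w 1 * I)‖ : ℝ) : ℂ)) ≠ 0 := by
      rw [Complex.ofReal_ne_zero]
      exact mul_ne_zero (mul_ne_zero ((abs_exp_sub_exp_neg_ne_zero_iff _).2 hx) (norm_ne_zero_iff.2 hn1)) (norm_ne_zero_iff.2 hn2)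
    simp only [div_eq_mul_inv] at hnum ⊢
    exact hnum.contDiffAt.mul (hden.inv hden0)
  · simp only [if_neg hw]
    have h02 : (Circle.exp (c w 0) : ℂ) ≠ Circle.exp (c w 2) := fun h => ((mem_regS_iff S c).1 hc).1 w hw (Subtype.ext h)
    simp only [div_eq_mul_inv]
    exact (((contDiff_coe_circleExp_mul_zpow w 0 2 (k w)).mul ((contDiff_coe_circleExp_coord w 0).mul (contDiff_coe_circleExp_coord w 2))).contDiffAt).mul
      (((contDiff_coe_circleExp_coord w 0).sub (contDiff_coe_circleExp_coord w 2)).contDiffAt.inv (sub_ne_zero.2 h02))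

/-- **THE PREFACTOR OF THE PAIRED PARTNER SUM IS `C^∞` ON `RegS S`**: `c ↦ archRH S c · κ · M♭_k(c)` for any constant `κ` (e.g. ★ `partnerWeight L α S`) — FILE A1's `M`.
[cite: Rogawski1990, §4.9 p. 55] [cite: Shelstad1979, §4 p. 22] -/
theorem contDiffOn_archRH_mul_prefactor (S : Finset W) (κ : ℂ) (k : W → ℤ) :
    ContDiffOn ℝ ∞ (fun c : W → Fin 3 → ℝ => archRH S c * κ * ∏ w : W, (if w ∈ S then
          -((((boostEig (c w) 0) * (boostEig (c w) 2)) ^ (k w)) * (((boostEig (c w) 1) - (boostEig (c w) 0)) * ((boostEig (c w) 1) - (boostEig (c w) 2))) /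
              (boostEig (c w) 1)) /
            ((|Real.exp (c w 0) - Real.exp (-c w 0)| *
                ‖Complex.exp (c w 0 + c w 2 * I) - Complex.exp (c w 1 * I)‖ * ‖Complex.exp (-c w 0 + c w 2 * I) - Complex.exp (c w 1 * I)‖ : ℝ) : ℂ)
        else (((Circle.exp (c w 0) : ℂ) * Circle.exp (c w 2)) ^ (k w)) * ((Circle.exp (c w 0) : ℂ) * Circle.exp (c w 2)) /
          ((Circle.exp (c w 0) : ℂ) - Circle.exp (c w 2)))) (RegS S) :=
  ((contDiffOn_archRH_regS S).mul contDiffOn_const).mul (contDiffOn_prefactor S k)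

end Literature.NumberTheory.Rogawski1990

end
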